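import Summits.PneNP.PneNP.Theorems.ExpanderLinearGeneratorsNoPolyBoundedProofSystemLadder
import Summits.PneNP.PneNP.Theorems.ExpanderLinearGeneratorsNoPolyBoundedProofSystemExpTime
import Summits.PneNP.PneNP.Theorems.ExpanderLinearGeneratorsNoPolyBoundedProofSystemBarriers
import Literature.Computability.Complexity.StructuralPHProofs

/-!
# Crux `ProofcplxThesis` (stmt-PneNP-0097) — kernel-checked companion of STRATEGY-CENSUS.md

`X := ¬ HasPolyBoundedProofSystem TAUT` (= `NP ≠ coNP`, `noPolyBoundedProofSystem_iff_NP_ne_coNP`),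
the rank-0 deciding hypothesis of route ExpanderLinearGenerators (decl
`ExpanderLinearGenerators.NoPolyBoundedProofSystem`, definitionally route ProofCplx's
`ProofcplxThesis`). This file does NOT attack `X`; it records, sorry-free, the logical shape of the
four strategy lenses of the census so that the census's claims about "which piece remains the whole
crux" are checked rather than asserted:

* §1 NEGATION — the forced structure of a counterexample world `¬X`: `NP = coNP`, `PH = NP`,
  `NE = coNE`, an optimal proof system exists, and (Kannan) `NP` has no fixed-polynomial-size
  circuits. Nothing in the list is contradictory (all of it holds relative to the in-tree
  Baker–Gill–Solovay oracle, `exists_computable_oracle_NPRel_eq_coNPRel`).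
* §2 "FREE HYPOTHESES" (decomposition by regime where one regime is a theorem): `X` is equivalent
  to `X` under the extra hypothesis "NP has no O(n^k)-size circuits for every k" (Kannan), and to
  "no OPTIMAL proof system for TAUT is polynomially bounded" (the universal quantifier of `X` may be
  restricted to optimal systems, of which there may be none).
* §3 DECOMPOSITION — the Frege-concentration split `X ↔ FregeLB ∧ Concentration`, exact; the census
  explains why `Concentration` is `X` in disguise.
* §4 STRENGTHEN — the weakest generator form: a one-bit-stretching `g ∈ FP` none of whose
  co-range slices is eventually covered by an `NP` set gives `X` (Rudich's demi-bits and Krajíček's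
  Conjecture 19.4/ProofcplxKrajicekGenerator are the average-case / immune strengthenings).

Sources: J. Krajíček, *Proof complexity* (CUP 2019) §19.2, §19.4, §21.1 (Cor. 21.1.3), §21.3–21.4
(Thm. 21.3.1, 21.3.3, 21.4.3); R. Kannan, Inf. Control 55 (1982) Thm. 2; S. Rudich, RANDOM 1997
(LNCS 1269) Def. 7 / Conj. 5; J. Krajíček, arXiv:2208.11642 §1, §3; S. A. Cook, R. A. Reckhow,
JSL 44 (1979) §1. Planner planner-cstrat-stmt-PneNP-0097-0 (crux-strategist), 2026-08-17.
-/

set_option linter.dupNamespace false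

namespace Summit.PneNP.PneNP.Cruxes.ProofcplxThesis

open Literature.Computability.Complexity Literature.Computability.MetaComplexity
open Literature.Barriers.PneNP
open Summit.PneNP.PneNP.Theses Summit.PneNP.PneNP.Theorems

/-- The crux, by its route name. -/
abbrev X : Prop := ExpanderLinearGenerators.NoPolyBoundedProofSystem

/-- The two route decls for stmt-PneNP-0097 are definitionally one statement. -/
theorem X_iff_proofcplxThesis : X ↔ ProofCplx.ProofcplxThesis := Iff.rfl

/-- "Optimal proof system for TAUT" (simulation-maximal), as in the ExpTime support file. -/
def IsOptimalTaut (V : List Bool → List Bool → Bool) : Prop :=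
  IsProofSystemFor V TAUT ∧ ∀ W : List Bool → List Bool → Bool, IsProofSystemFor W TAUT → Simulates V W

/-! ## §1 Negation: the counterexample world -/

/-- **Kannan inside `¬X`.** If `X` fails then `NP` has, for every `k`, a language without
`O(n^k)`-size circuits: `¬X` gives `NP = coNP`, hence `PH = NP` (Stockmeyer), and Kannan's
`Σ₂ᵖ ∩ Π₂ᵖ`-language with no `O(n^k)` circuits lies in `PH = NP`.
[cite: Kannan1982, Thm. 2] [cite: KrajicekProofComplexity2019, §21.1] -/
theorem NP_not_fixedPolySize_of_not_X (h : ¬ X) (k : ℕ) :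
    ∃ L ∈ Nondeterministic.NP, L ∉ ⋃ c : ℕ, SIZE (fun n => c * n ^ k + c) := by
  obtain ⟨L, hL, hLk⟩ := kannan_holds k
  have hPH : PH = Nondeterministic.NP := PH_eq_NP_of_not_noPolyBoundedProofSystem h
  refine ⟨L, ?_, hLk⟩
  rw [← hPH]
  exact SigmaP_subset_PH 2 hL.1

/-- **The forced structure of a counterexample (`¬X`-world), kernel-checked conjunction**:
`NP = coNP`, `PH = NP`, `coNE = NE`, an optimal proof system for `TAUT` exists (the p-bounded one),
and `NP ⊄ SIZE(O(n^k))` for every `k`. No two conjuncts are known to be contradictory; all hold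
relative to an oracle (§1b). [cite: KrajicekProofComplexity2019, §21.1 (Cor. 21.1.3)]
[cite: Kannan1982, Thm. 2] -/
theorem notX_world (h : ¬ X) :
    Nondeterministic.NP = coNP ∧ PH = Nondeterministic.NP ∧ co NE = NE ∧
      (∃ V, IsOptimalTaut V ∧ IsPolyBounded V) ∧
      (∀ k : ℕ, ∃ L ∈ Nondeterministic.NP, L ∉ ⋃ c : ℕ, SIZE (fun n => c * n ^ k + c)) := by
  have hNC : Nondeterministic.NP = coNP := by
    by_contra hne
    exact h (noPolyBoundedProofSystem_of_NP_ne_coNP hne)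
  refine ⟨hNC, PH_eq_NP_of_not_noPolyBoundedProofSystem h,
    co_NE_eq_NE_of_not_noPolyBoundedProofSystem h, ?_, NP_not_fixedPolySize_of_not_X h⟩
  -- the polynomially bounded system is itself optimal
  have hX : HasPolyBoundedProofSystem TAUT := by
    by_contra hX
    exact h hX
  obtain ⟨V, hV, p, hp⟩ := hX
  refine ⟨V, ⟨hV, fun W hW => ⟨p, fun x π hπ => ?_⟩⟩, ⟨p, hp⟩⟩
  obtain ⟨π₀, hπ₀⟩ := (hV.mem_iff x).1 (hW.mem_of_eq_true hπ)
  obtain ⟨π', hlen, hπ'⟩ := hp x π₀ hπ₀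
  exact ⟨π', hlen.trans (TM2Iter.eval_mono p (Nat.le_add_right _ _)), hπ'⟩

/-- **§1b. The counterexample world is relativized-consistent**: there is a computable oracle
relative to which `NP = coNP` (Baker–Gill–Solovay), so the statement shape of `X` does not
relativize — any obstruction to the counterexample must be non-relativizing (and, by the
algebrization entries of the Barriers support file, non-algebrizing). Re-exported here so the
census cites one file. [cite: BakerGillSolovay1975, Thm. 1] -/
theorem notX_shape_has_oracle_model : ¬ Relativizes fun O => NPRel O ≠ coNPRel O :=
  not_relativizes_NPRel_ne_coNPRel

/-! ## §2 Free hypotheses (regime splits with one regime a theorem) -/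

/-- **Anti-hardness implies `X`**: if `NP` had fixed-polynomial-size circuits (`NP ⊆ SIZE(O(n^k))`
for one `k`), then `NP ≠ coNP` — Kannan's theorem contraposed through `PH = NP`. (Cf. Krajíček's
hypothesis (H) `P ⊆ SIZE(n^d) ⟹ P ≠ NP`, arXiv:2208.11642 §2.) [cite: Kannan1982, Thm. 2]
[cite: Krajicek2022, §2 (Hypothesis (H))] -/
theorem X_of_NP_fixedPolySize
    (h : ∃ k : ℕ, ∀ L ∈ Nondeterministic.NP, L ∈ ⋃ c : ℕ, SIZE (fun n => c * n ^ k + c)) : X := by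
  by_contra hX
  obtain ⟨k, hk⟩ := h
  obtain ⟨L, hL, hLk⟩ := NP_not_fixedPolySize_of_not_X hX k
  exact hLk (hk L hL)

/-- **Kannan normal form**: to prove `X` one may assume, for free, fixed-polynomial circuit lower
bounds for `NP` (for every `k` some `NP` language has no `O(n^k)`-size circuits).
[cite: Kannan1982, Thm. 2] -/
theorem X_iff_of_NP_hard :
    X ↔ ((∀ k : ℕ, ∃ L ∈ Nondeterministic.NP, L ∉ ⋃ c : ℕ, SIZE (fun n => c * n ^ k + c)) → X) := by
  refine ⟨fun h _ => h, fun h => ?_⟩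
  by_contra hX
  exact hX (h (NP_not_fixedPolySize_of_not_X hX))

/-- **Optimality normal form**: `X` iff no OPTIMAL proof system for `TAUT` is polynomially
bounded. (`→` is trivial; `←`: a polynomially bounded system is optimal.) So the universal
quantifier "every Cook–Reckhow system" of `X` may be restricted to optimal systems — a class that
is empty if Krajíček–Pudlák's optimality problem has a negative answer, in which case `X` holds
outright (`noPolyBoundedProofSystem_of_no_optimal`). [cite: KrajicekProofComplexity2019, §21.1]
[cite: KrajicekPudlak1989, §1] -/
theorem X_iff_no_optimal_isPolyBounded :
    X ↔ ∀ V, IsOptimalTaut V → ¬ IsPolyBounded V := by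
  constructor
  · intro hX V hV hPB
    exact hX ⟨V, hV.1, hPB⟩
  · intro h
    by_contra hX
    obtain ⟨-, -, -, ⟨V, hV, hPB⟩, -⟩ := notX_world hX
    exact h V hV hPB

/-- The optimality case split, spelled out: either there is no optimal proof system (and `X`
holds), or proving `X` means proving a lower bound for an optimal one.
[cite: KrajicekProofComplexity2019, §21.1 (Cor. 21.1.2, 21.1.3)] -/
theorem X_iff_optimal_dichotomy :
    X ↔ (¬ ∃ V, IsOptimalTaut V) ∨ ((∃ V, IsOptimalTaut V) ∧ ∀ V, IsOptimalTaut V → ¬ IsPolyBounded V) := by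
  rw [X_iff_no_optimal_isPolyBounded]
  constructor
  · intro h
    by_cases hopt : ∃ V, IsOptimalTaut V
    · exact Or.inr ⟨hopt, h⟩
    · exact Or.inl hopt
  · rintro (hno | ⟨-, h⟩)
    · exact fun V hV _ => hno ⟨V, hV⟩
    · exact h

/-! ## §3 Decomposition: the Frege-concentration split -/

/-- `Concentration`: "if any proof system is polynomially bounded then already the textbook Frege
system is". Implied by `X` (vacuously) and by "textbookFrege is optimal"; no independent attack is
known (census §Decomposition D1). -/
def Concentration : Prop := HasPolyBoundedProofSystem TAUT → textbookFrege.IsPolyBounded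

/-- **The Frege-concentration split is exact**: `X ↔ (Frege lower bound) ∧ Concentration`.
`→`: `X` gives the Frege lower bound (Cook–Reckhow Prop. 1.1 + Cor. 2.4, tree:
`not_isPolyBounded_textbookFrege_of_noPolyBoundedProofSystem`) and `Concentration` vacuously;
`←`: modus tollens. Given the first conjunct, the second is literally `X` — the split isolates the
famous necessary condition (route ProofCplx crux #3) but leaves `X` whole in the other piece.
[cite: CookReckhow1979, §1–2 (Prop. 1.1, Cor. 2.4)] -/
theorem X_iff_fregeLB_and_concentration :
    X ↔ (¬ textbookFrege.IsPolyBounded) ∧ Concentration := by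
  constructor
  · intro hX
    exact ⟨not_isPolyBounded_textbookFrege_of_noPolyBoundedProofSystem hX, fun h => absurd h hX⟩
  · rintro ⟨hF, hC⟩ hPB
    exact hF (hC hPB)

/-- Under the Frege lower bound, `Concentration` is equivalent to `X` itself (why D1 is no
leverage). [cite: CookReckhow1979, §1–2] -/
theorem concentration_iff_X_of_fregeLB (hF : ¬ textbookFrege.IsPolyBounded) :
    Concentration ↔ X :=
  ⟨fun hC hPB => hF (hC hPB), fun hX h => absurd h hX⟩

/-! ## §4 Strengthen: the weakest generator form -/

/-- `CoRangeNotNPCovered g`: no `NP` language sound for the co-range of `g` (i.e. contained in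
`(range g)ᶜ`) contains ALL non-images of length `n + 1` for all large `n` — for infinitely many
`n` it misses one. This is the weakest "hardness for all proof systems" of the τ-formulas of `g`
(some `τ(g)_b` of infinitely many lengths has no short proof in a given system); Krajíček's
Conjecture (ProofcplxKrajicekGenerator: the co-range is `NP`-immune) and Rudich's demi-bits
(most non-images have no short proofs in any system) are its strengthenings.
[cite: Krajicek2022, §1 (Conjecture 1.1)] [cite: Rudich1997, Def. 7 and Conjecture 5] -/
def CoRangeNotNPCovered (g : List Bool → List Bool) : Prop :=
  ∀ L ∈ Nondeterministic.NP, (∀ b ∈ L, b ∉ Set.range g) →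
    ∀ N : ℕ, ∃ n ≥ N, ∃ b : List Bool, b.length = n + 1 ∧ b ∉ Set.range g ∧ b ∉ L

/-- **A one-bit-stretching `g ∈ FP` whose co-range is not eventually `NP`-covered gives `X`.**
If `X` failed, `NP = coNP` would put `(range g)ᶜ` itself in `NP` (the range is in `NP`,
`range_mem_NP_of_stretching`), an `NP` set covering every non-image.
[cite: Krajicek2022, §1 (p. 4)] [cite: CookReckhow1979, §1 Prop. 1.4] -/
theorem X_of_coRangeNotNPCovered {g : List Bool → List Bool} (hg : g ∈ FP)
    (hlen : ∀ x, (g x).length = x.length + 1) (hhard : CoRangeNotNPCovered g) : X := by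
  by_contra hX
  obtain ⟨hNC, -⟩ := notX_world hX
  have hR : (Set.range g : Language Bool) ∈ Nondeterministic.NP := range_mem_NP_of_stretching hg hlen
  have hRc : ((Set.range g)ᶜ : Language Bool) ∈ Nondeterministic.NP := by
    rw [hNC]
    show ((Set.range g : Language Bool)ᶜ)ᶜ ∈ Nondeterministic.NP
    rw [compl_compl]
    exact hR
  obtain ⟨n, -, b, -, hb, hbL⟩ := hhard _ hRc (fun b hb => hb) 0
  exact hbL hb

/-- Krajíček's immune form implies the weak form (so §4 sits below route ProofCplx's crux #2 and
above `X`). [cite: Krajicek2022, §1 (Conjecture 1.1)] -/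
theorem coRangeNotNPCovered_of_hits {g : List Bool → List Bool}
    (hlen : ∀ x, (g x).length = x.length + 1)
    (hhit : ∀ L ∈ Nondeterministic.NP, L.Infinite → ∃ x, g x ∈ L) : CoRangeNotNPCovered g := by
  intro L hL hLsub N
  -- an NP set inside the co-range is finite, so beyond its longest element every non-image is missed
  have hfin : L.Finite := by
    by_contra hinf
    obtain ⟨x, hx⟩ := hhit L hL hinf
    exact hLsub _ hx ⟨x, rfl⟩
  obtain ⟨M, hM⟩ := (hfin.image List.length).bddAbove
  obtain ⟨b, hb, hbR⟩ := exists_length_succ_not_mem_range hlen (max N M)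
  refine ⟨max N M, le_max_left _ _, b, hb, hbR, fun hbL => ?_⟩
  have : b.length ≤ M := hM ⟨b, hbL, rfl⟩
  omega

end Summit.PneNP.PneNP.Cruxes.ProofcplxThesis
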